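import Mathlib
import HarnessLib
import Summits.NavierStokesRegularity.NavierStokesRegularity.Theorems.TaylorModelRungThreeCertificateReadoutVStepWinP

/-!
# Crux K1b-DR (stmt-NavierStokesRegularity-23954), line `taylor-model` — v3 read-outs, K-SIDE part 5-WP: the LAYOUT of the windowed
# read-outs with the POINCARÉ-CORRECTED base landing (ns-tm-g4 g6): `roInWinP`/`roInWinP'`, the per-stage Boolean
# `checkReadoutStageWinP'`, **`checkReadoutsWinP' kitOf wT A WV`** (THE read-out Boolean of the P-assembly), and the records
# `toReadoutDataWinP` / `toWinDataP` presented to `TaylorModelV.ReadoutsVP`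

Same emitted data as the windowed layout (`WindowsV`, part 5-W): NOTHING new is emitted — the level-0 hull radii `ρ0` are the kernel's
own `radLW 0` at node `S−1`, and under `ReadoutsVP` the level-0 window `[u0lo, u0hi]` brackets the CENTRE POLYNOMIAL's crossing only
(cert-1's `τc ± 2⁻⁴⁶` is right as delivered).  The generator switches `checkReadoutsWin'` ↦ `checkReadoutsWinP'` and the closer to
`k1bDR_of_checksVRGCWinP'` (file `…CertificateCloserVWinP`, after the G-side `k1bDR_of_validVP`).

* `roInWinP j` (semantic: `roInWin j` + `radLW 0 (nodeVW j (S−1))`), `roInWinP' j` (checkpoint: `roInWin' j` + `rho0' j`), `roInWinP'_eq`;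
* `roOutWinP/roOutWinP'` (+ `_eq`), `checkReadoutStageWinP'` (+ `_eq`), `checkReadoutsWinP'`;
* `toReadoutDataWinP G ΛT` (fat `Y0/Y1`, windowed kernel box), `toWinDataP` (`zlo/zhi 0` := the CENTRE-ONLY box `Z0c`, `zlo/zhi 1` := `Z1`,
  windows as emitted); rfl lemmas.

Definitions + `rfl`/rewrite lemmas only.  HONEST FRAMING: kernel bookkeeping for the MODEL certificate №23954 (rung TL-M3);
nothing here is a statement about the Navier–Stokes equations, and nothing is asserted.
-/

-- the sub-problem namespace repeats the summit name by design (D-0017)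
set_option linter.dupNamespace false

namespace Summit.NavierStokesRegularity.NavierStokesRegularity.Theorems.TaylorModelCert

open scoped BigOperators
open Literature.Analysis.FluidPDE.TaoCascade Literature.Analysis.FluidPDE.TaoCascade.TaylorChain
open Summit.NavierStokesRegularity.NavierStokesRegularity.Theorems.TaylorModelV

namespace CertTablesV

section Defs

variable (TV : CertTablesV) (kitOf : ℕ → CoreKit) (wT : ℕ → Array Dyad) (A : ReadoutAux QS2) (WV : WindowsV)

/-- Level-0 hull radii at node `S−1` of stage `j` (semantic form: the node of the recursion). [folklore] -/
def rho0 (j : ℕ) : Array Dyad := TV.radLW kitOf wT j 0 (TV.nodeVW kitOf wT j ((TV.base.stage j).S - 1))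

/-- `rho0'` (checkpoint form, `…ReadoutVDiagWinP`) is `rho0`. [folklore] -/
theorem rho0'_eq (j : ℕ) : TV.rho0' kitOf wT j = TV.rho0 kitOf wT j := by
  simp only [rho0', rho0, nodeVW, StageCtx.startNode_eq_nodeAt]

/-- **The P-input of stage `j`** (semantic form). [folklore] -/
def roInWinP (j : ℕ) : ROInWinP := ⟨TV.roInWin kitOf wT A WV j, TV.rho0 kitOf wT j⟩

/-- **The P-input of stage `j`, CHECKPOINT FORM** — the form the kernel evaluates. [folklore] -/
def roInWinP' (j : ℕ) : ROInWinP := ⟨TV.roInWin' kitOf wT A WV j, TV.rho0' kitOf wT j⟩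

/-- `roInWinP'` is `roInWinP`. [folklore] -/
theorem roInWinP'_eq (j : ℕ) : TV.roInWinP' kitOf wT A WV j = TV.roInWinP kitOf wT A WV j := by
  simp only [roInWinP', roInWinP, roInWin'_eq, rho0'_eq]

/-- The P read-out step output of stage `j`. [folklore] -/
def roOutWinP (j : ℕ) : ROOutWin := TV.base.readoutStepWinP (TV.roInWinP kitOf wT A WV j)

/-- The P read-out step output of stage `j`, checkpoint form. [folklore] -/
def roOutWinP' (j : ℕ) : ROOutWin := TV.base.readoutStepWinP (TV.roInWinP' kitOf wT A WV j)

/-- `roOutWinP'` is `roOutWinP`. [folklore] -/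
theorem roOutWinP'_eq (j : ℕ) : TV.roOutWinP' kitOf wT A WV j = TV.roOutWinP kitOf wT A WV j := by
  simp only [roOutWinP', roOutWinP, roInWinP'_eq]

/-- **Per-stage P read-out check, checkpoint form.** [folklore] -/
def checkReadoutStageWinP' (j : ℕ) : Bool := (TV.roOutWinP' kitOf wT A WV j).ok

/-- **All stages, checkpoint form**, plus the surrogate certification — THE READ-OUT BOOLEAN OF THE P-ASSEMBLY. [folklore] -/
def checkReadoutsWinP' : Bool :=
  TV.base.checkReadoutAux A && allN (TV.base.N₀ + 1) fun j => TV.checkReadoutStageWinP' kitOf wT A WV j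

/-- `checkReadoutStageWinP'` is the verdict of the semantic-form step. [folklore] -/
theorem checkReadoutStageWinP'_eq (j : ℕ) : TV.checkReadoutStageWinP' kitOf wT A WV j = (TV.roOutWinP kitOf wT A WV j).ok := by
  simp only [checkReadoutStageWinP', roOutWinP'_eq]

/-! ### The records presented to `ReadoutsVP` -/

/-- **The `ReadoutData` record of the P read-outs**: fat `Y0/Y1` ((R6)/(R7)), windowed kernel box ((R10w)); `G`, `ΛT` passed through.
[folklore] -/
noncomputable def toReadoutDataWinP (G : ℕ → ℕ → ℕ → ℝ) (ΛT : ℕ → ℝ) : ReadoutData where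
  ylo := fun l j => match l with
    | ⟨0, _⟩ => TV.base.vecF (IntervalD.loR (TV.roOutWinP kitOf wT A WV j).Y0)
    | ⟨_ + 1, _⟩ => TV.base.vecF (IntervalD.loR (TV.roOutWinP kitOf wT A WV j).Y1)
  yhi := fun l j => match l with
    | ⟨0, _⟩ => TV.base.vecF (IntervalD.hiR (TV.roOutWinP kitOf wT A WV j).Y0)
    | ⟨_ + 1, _⟩ => TV.base.vecF (IntervalD.hiR (TV.roOutWinP kitOf wT A WV j).Y1)
  Vlo := fun j => TV.base.kerLo (TV.roOutWinP kitOf wT A WV j).VB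
  Vhi := fun j => TV.base.kerHi (TV.roOutWinP kitOf wT A WV j).VB
  G := G
  ΛT := ΛT

/-- **The `WinData` record of the P read-outs**: windows as emitted; `zlo/zhi 0` = the CENTRE-ONLY box `Z0c`, `zlo/zhi 1` = `Z1`.
[folklore] -/
noncomputable def toWinDataP : WinData where
  ulo := fun l j => match l with
    | ⟨0, _⟩ => (winAt WV j).u0lo.toReal
    | ⟨_ + 1, _⟩ => (winAt WV j).u1lo.toReal
  uhi := fun l j => match l with
    | ⟨0, _⟩ => (winAt WV j).u0hi.toReal
    | ⟨_ + 1, _⟩ => (winAt WV j).u1hi.toReal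
  zlo := fun l j => match l with
    | ⟨0, _⟩ => TV.base.vecF (IntervalD.loR (TV.roOutWinP kitOf wT A WV j).Z0)
    | ⟨_ + 1, _⟩ => TV.base.vecF (IntervalD.loR (TV.roOutWinP kitOf wT A WV j).Z1)
  zhi := fun l j => match l with
    | ⟨0, _⟩ => TV.base.vecF (IntervalD.hiR (TV.roOutWinP kitOf wT A WV j).Z0)
    | ⟨_ + 1, _⟩ => TV.base.vecF (IntervalD.hiR (TV.roOutWinP kitOf wT A WV j).Z1)

end Defs

/-! ### Field reductions (all definitional) -/

section Rfl

variable {TV : CertTablesV} {kitOf : ℕ → CoreKit} {wT : ℕ → Array Dyad} {A : ReadoutAux QS2} {WV : WindowsV}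

/-- [folklore] -/ theorem roInWinP_win (j : ℕ) : (TV.roInWinP kitOf wT A WV j).win = TV.roInWin kitOf wT A WV j := rfl
/-- [folklore] -/ theorem roInWinP_rho (j : ℕ) : (TV.roInWinP kitOf wT A WV j).ρ0 = TV.rho0 kitOf wT j := rfl
/-- [folklore] -/
theorem roOutWinP_ok (j : ℕ) : (TV.roOutWinP kitOf wT A WV j).ok = (TV.base.readoutStepWinP (TV.roInWinP kitOf wT A WV j)).ok := rfl
/-- [folklore] -/
theorem rowP_ylo0 (G : ℕ → ℕ → ℕ → ℝ) (ΛT : ℕ → ℝ) (j : ℕ) :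
    (TV.toReadoutDataWinP kitOf wT A WV G ΛT).ylo 0 j = TV.base.vecF (IntervalD.loR ((TV.roIn kitOf wT A j).Y0 TV.base)) := rfl
/-- [folklore] -/
theorem rowP_yhi0 (G : ℕ → ℕ → ℕ → ℝ) (ΛT : ℕ → ℝ) (j : ℕ) :
    (TV.toReadoutDataWinP kitOf wT A WV G ΛT).yhi 0 j = TV.base.vecF (IntervalD.hiR ((TV.roIn kitOf wT A j).Y0 TV.base)) := rfl
/-- [folklore] -/
theorem rowP_ylo1 (G : ℕ → ℕ → ℕ → ℝ) (ΛT : ℕ → ℝ) (j : ℕ) :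
    (TV.toReadoutDataWinP kitOf wT A WV G ΛT).ylo 1 j = TV.base.vecF (IntervalD.loR ((TV.roIn kitOf wT A j).Y1 TV.base)) := rfl
/-- [folklore] -/
theorem rowP_yhi1 (G : ℕ → ℕ → ℕ → ℝ) (ΛT : ℕ → ℝ) (j : ℕ) :
    (TV.toReadoutDataWinP kitOf wT A WV G ΛT).yhi 1 j = TV.base.vecF (IntervalD.hiR ((TV.roIn kitOf wT A j).Y1 TV.base)) := rfl
/-- [folklore] -/
theorem rowP_Vlo (G : ℕ → ℕ → ℕ → ℝ) (ΛT : ℕ → ℝ) (j : ℕ) :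
    (TV.toReadoutDataWinP kitOf wT A WV G ΛT).Vlo j = TV.base.kerLo ((TV.roInWin kitOf wT A WV j).VBw TV.base) := rfl
/-- [folklore] -/
theorem rowP_Vhi (G : ℕ → ℕ → ℕ → ℝ) (ΛT : ℕ → ℝ) (j : ℕ) :
    (TV.toReadoutDataWinP kitOf wT A WV G ΛT).Vhi j = TV.base.kerHi ((TV.roInWin kitOf wT A WV j).VBw TV.base) := rfl
/-- [folklore] -/ theorem rwP_ulo0 (j : ℕ) : (TV.toWinDataP kitOf wT A WV).ulo 0 j = (winAt WV j).u0lo.toReal := rfl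
/-- [folklore] -/ theorem rwP_uhi0 (j : ℕ) : (TV.toWinDataP kitOf wT A WV).uhi 0 j = (winAt WV j).u0hi.toReal := rfl
/-- [folklore] -/ theorem rwP_ulo1 (j : ℕ) : (TV.toWinDataP kitOf wT A WV).ulo 1 j = (winAt WV j).u1lo.toReal := rfl
/-- [folklore] -/ theorem rwP_uhi1 (j : ℕ) : (TV.toWinDataP kitOf wT A WV).uhi 1 j = (winAt WV j).u1hi.toReal := rfl
/-- [folklore] -/
theorem rwP_zlo0 (j : ℕ) : (TV.toWinDataP kitOf wT A WV).zlo 0 j = TV.base.vecF (IntervalD.loR ((TV.roInWin kitOf wT A WV j).Z0c TV.base)) := rfl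
/-- [folklore] -/
theorem rwP_zhi0 (j : ℕ) : (TV.toWinDataP kitOf wT A WV).zhi 0 j = TV.base.vecF (IntervalD.hiR ((TV.roInWin kitOf wT A WV j).Z0c TV.base)) := rfl
/-- [folklore] -/
theorem rwP_zlo1 (j : ℕ) : (TV.toWinDataP kitOf wT A WV).zlo 1 j = TV.base.vecF (IntervalD.loR ((TV.roInWin kitOf wT A WV j).Z1 TV.base)) := rfl
/-- [folklore] -/
theorem rwP_zhi1 (j : ℕ) : (TV.toWinDataP kitOf wT A WV).zhi 1 j = TV.base.vecF (IntervalD.hiR ((TV.roInWin kitOf wT A WV j).Z1 TV.base)) := rfl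

end Rfl

end CertTablesV

end Summit.NavierStokesRegularity.NavierStokesRegularity.Theorems.TaylorModelCert
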